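import Literature.Analysis.FunctionSpaces.PoissonMeckeProofs
import HarnessLib

/-!
# Conditional means of increasing Poisson functionals given the counts of a disjoint family

(topic Analysis/FunctionSpaces, next to `PoissonMeckeProofs` and `PoissonCountFKG`; no new
definitions, no new named facts.)

Let `P` be (the law of) a Poisson point process on a second countable Hausdorff Borel space `E`
with σ-finite intensity `ν` (`IsPoissonPointProcess ν P`, Kingman's axioms), `t : ι → Set E` a
countable pairwise disjoint family of measurable sets, and for `n : ι → ℕ` let
`C(n) = {c | ∀ i, N_c(t i) = n i}` be the **count cylinder** of configurations with exactly `n i`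
points in each `t i`; write `n + e_j = Function.update n j (n j + 1)`.

## Main results (all proved)
* `IsPoissonPointProcess.mul_setLIntegral_eq_setLIntegral_setLIntegral_insert` — **the Mecke
  equation on an event**: if `N_c(B) = k` on `A'` and `c ∪ {x} ∈ A' ↔ c ∈ A` for `x ∈ B` not a
  point of `c`, then `k · ∫_{A'} f dP = ∫_B ∫_A f(c ∪ {x}) P(dc) ν(dx)` for measurable `f ≥ 0`
  (Last–Penrose 2017, Thm 4.1, for `F(c, x) = 1_B(x) 1_{A'}(c) f(c)`).
* `IsPoissonPointProcess.succ_mul_setLIntegral_cylinder_succ_eq` — **Mecke on a count cylinder**: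
  `(n j + 1) · ∫_{C(n + e_j)} f dP = ∫_{t j} ∫_{C(n)} f(c ∪ {x}) P(dc) ν(dx)`: for `x ∈ t j` not
  in `c` (a.s., `measure_setOf_mem_eq_zero`), inserting `x` raises `N(t j)` by one and no other
  count (`count_union_ofFn_one`, disjointness), so `c ∪ {x} ∈ C(n + e_j) ↔ c ∈ C(n)`.
* `IsPoissonPointProcess.measure_cylinder_succ_mul_eq` — the **Poisson recursion**
  `P(C(n + e_j)) · (n j + 1) = P(C(n)) · ν(t j)` (the case `f = 1`), and the upward propagation
  of null cylinders `measure_cylinder_succ_eq_zero`, `measure_cylinder_eq_zero_of_le`.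
* `IsPoissonPointProcess.setLIntegral_cylinder_mul_measure_succ_le` — **monotonicity of the
  conditional means, one step** (cross-multiplied, division-free): for `f ≥ 0` measurable and
  increasing for inclusion of configurations,
  `(∫_{C(n)} f dP) · P(C(n + e_j)) ≤ (∫_{C(n + e_j)} f dP) · P(C(n))`
  (from `f(c ∪ {x}) ≥ f(c)`: `(n j + 1) ∫_{C(n+e_j)} f ≥ ν(t j) ∫_{C(n)} f`; multiply by `P(C(n))`,
  substitute the recursion, cancel `0 < n j + 1 < ∞`).
* `IsPoissonPointProcess.setLIntegral_cylinder_mul_measure_le_of_le` — the same along the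
  coordinatewise order, `ι` finite, `n ≤ m`: `(∫_{C(n)} f dP) · P(C(m)) ≤ (∫_{C(m)} f dP) · P(C(n))`
  (induction along a monotone lattice path, `pi_nat_le_induction`; transitivity of the
  cross-multiplied inequality through middle cylinders of positive finite probability).

No finiteness of the `ν (t i)` is assumed, and null cylinders need no separate treatment in the
cross-multiplied form (if `P(C(n)) = 0` or `P(C(m)) = 0`, `n ≤ m`, both sides vanish).

## Intent (what this is for; the limit is NOT here)
The last two results say that `n ↦ 𝔼[f | N⃗ = n] = (∫_{C(n)} f dP) / P(C(n))` is coordinatewise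
increasing on the cylinders of positive probability, for every increasing `f`. Combined with
Harris' lemma for the count vector `N⃗ = (N(t i))_i` (`PoissonCountFKG.lean`,
`IsPoissonPointProcess.isPositivelyAssociated_map_counts`) this gives
`𝔼[𝔼[f | N⃗] 𝔼[g | N⃗]] ≥ 𝔼 f · 𝔼 g` for increasing `f, g`, and a martingale limit along partitions
generating the count σ-algebra then yields the Harris–FKG inequality `𝔼[f g] ≥ 𝔼 f · 𝔼 g` for
increasing Poisson functionals (Last–Penrose 2017, Thm 20.4; Roy's route "by reduction to the
discrete version", notes to Ch. 20), as used cell by cell for Poisson–Voronoi percolation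
(Benjamini–Schramm 1998, §7). The martingale limit is not in this file.

## References
* G. Last, M. Penrose, *Lectures on the Poisson Process*, Cambridge University Press (2017),
  Thm 4.1 (Mecke equation) [cite: LastPenrose2017, Thm 4.1]; §20.3, Thm 20.4 (Harris–FKG) and the
  notes to Ch. 20 [cite: LastPenrose2017, Thm 20.4].
* J. F. C. Kingman, *Poisson Processes*, Oxford University Press (1993), §2.1.
* I. Benjamini, O. Schramm, Conformal invariance of Voronoi percolation,
  *Comm. Math. Phys.* 197 (1998), 75–107, §7.
-/

open MeasureTheory ProbabilityTheory Filter Set TopologicalSpace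
open scoped ENNReal NNReal Topology

namespace Literature.Analysis.FunctionSpaces

/-! ## Two combinatorial lemmas: lattice paths in `ι → ℕ`, cross-multiplied monotonicity -/

/-- **Induction along monotone lattice paths.** On `ι → ℕ` (`ι` finite, coordinatewise order) a
relation which is reflexive, transitive along chains `n ≤ k ≤ m` and holds for every elementary
step `n ↦ n + e_j = Function.update n j (n j + 1)` holds for all `n ≤ m` (induction on
`∑ i, (m i - n i)`: if `n < m` some coordinate can be raised by one inside `[n, m]`). [folklore] -/
theorem pi_nat_le_induction {ι : Type*} [Fintype ι] [DecidableEq ι]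
    {Q : (ι → ℕ) → (ι → ℕ) → Prop} (hrefl : ∀ n, Q n n)
    (htrans : ∀ n k m, n ≤ k → k ≤ m → Q n k → Q k m → Q n m)
    (hstep : ∀ n j, Q n (Function.update n j (n j + 1))) {n m : ι → ℕ} (hnm : n ≤ m) :
    Q n m := by
  suffices H : ∀ (d : ℕ) (k : ι → ℕ), k ≤ m → ∑ i, (m i - k i) = d → Q k m from H _ n hnm rfl
  intro d
  induction d using Nat.strong_induction_on with
  | _ d ih =>
    intro k hkm hsum
    by_cases hk : k = m
    · rw [hk]; exact hrefl m
    obtain ⟨j, hj⟩ : ∃ j, k j < m j := by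
      by_contra! hcon
      exact hk (le_antisymm hkm hcon)
    have hkk' : k ≤ Function.update k j (k j + 1) :=
      le_update_iff.2 ⟨Nat.le_succ _, fun i _ => le_rfl⟩
    have hk'm : Function.update k j (k j + 1) ≤ m := update_le_iff.2 ⟨hj, fun i _ => hkm i⟩
    refine htrans k _ m hkk' hk'm (hstep k j) (ih _ ?_ _ hk'm rfl)
    rw [← hsum]
    exact Finset.sum_lt_sum (fun i _ => Nat.sub_le_sub_left (hkk' i) _)
      ⟨j, Finset.mem_univ j, by rw [Function.update_self]; omega⟩

/-- **Cross-multiplied monotonicity along lattice paths** (the algebra of "`n ↦ a n / p n` is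
coordinatewise increasing" without division). For `a p : (ι → ℕ) → ℝ≥0∞` with `p` finite and `a`
vanishing where `p` does, the one-step inequalities `a n · p (n + e_j) ≤ a (n + e_j) · p n` and
one-step propagation of the zeros of `p` give `a n · p m ≤ a m · p n` and `p n = 0 → p m = 0` for
all `n ≤ m` (transitivity through a middle term with `0 < p k < ∞`). [folklore] -/
theorem mul_le_mul_of_le_of_update_succ {ι : Type*} [Fintype ι] [DecidableEq ι]
    {a p : (ι → ℕ) → ℝ≥0∞} (hp : ∀ k, p k ≠ ∞) (hap : ∀ k, p k = 0 → a k = 0)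
    (hstep : ∀ k j,
      a k * p (Function.update k j (k j + 1)) ≤ a (Function.update k j (k j + 1)) * p k)
    (hzero : ∀ k j, p k = 0 → p (Function.update k j (k j + 1)) = 0) {n m : ι → ℕ}
    (hnm : n ≤ m) :
    a n * p m ≤ a m * p n ∧ (p n = 0 → p m = 0) := by
  refine pi_nat_le_induction (Q := fun k l => a k * p l ≤ a l * p k ∧ (p k = 0 → p l = 0))
    (fun k => ⟨le_rfl, id⟩) (fun k l o _ _ hkl hlo => ?_) (fun k j => ⟨hstep k j, hzero k j⟩) hnm
  obtain ⟨hkl, hkl0⟩ := hkl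
  obtain ⟨hlo, hlo0⟩ := hlo
  refine ⟨?_, fun hk => hlo0 (hkl0 hk)⟩
  by_cases hl : p l = 0
  · rw [hlo0 hl, hap o (hlo0 hl), mul_zero, zero_mul]
  · rw [← ENNReal.mul_le_mul_iff_right hl (hp l)]
    calc p l * (a k * p o) = (a k * p l) * p o := by ring
      _ ≤ (a l * p k) * p o := mul_le_mul' hkl le_rfl
      _ = (a l * p o) * p k := by ring
      _ ≤ (a o * p l) * p k := mul_le_mul' hlo le_rfl
      _ = p l * (a o * p k) := by ring

namespace PointConfig

variable {E : Type*} [TopologicalSpace E]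

/-! ## Count cylinders: measurability, and the effect of inserting one point -/

/-- A count cylinder `{c | ∀ i, N_c(t i) = n i}` over a countable family of measurable sets is
measurable (cf. `measurableSet_setOf_count_eq` for `Fin r`-indexed families). [folklore] -/
theorem measurableSet_setOf_forall_count_eq [MeasurableSpace E] {ι : Type*} [Countable ι]
    {t : ι → Set E} (ht : ∀ i, MeasurableSet (t i)) (n : ι → ℕ) :
    MeasurableSet {c : PointConfig E | ∀ i, c.count (t i) = (n i : ℕ∞)} := by
  have : {c : PointConfig E | ∀ i, c.count (t i) = (n i : ℕ∞)} =
      ⋂ i, (fun c : PointConfig E => c.count (t i)) ⁻¹' {(n i : ℕ∞)} := by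
    ext c; simp
  rw [this]
  exact MeasurableSet.iInter fun i => measurable_count (ht i) (measurableSet_singleton _)

/-- **Inserting a point of `t j` moves the cylinder `C(n)` to `C(n + e_j)`**: for a pairwise
disjoint family `t`, `x ∈ t j` and `x ∉ c`, `c ∪ {x} ∈ C(n + e_j) ↔ c ∈ C(n)` — inserting `x`
raises the count of `t j` by one (`count_union_ofFn_one`) and no other (disjointness). [folklore] -/
theorem union_ofFn_one_mem_setOf_forall_count_eq_iff {ι : Type*} [DecidableEq ι] {t : ι → Set E}
    (hd : Pairwise (Function.onFun Disjoint t)) (n : ι → ℕ) {j : ι} {x : E} (hx : x ∈ t j)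
    {c : PointConfig E} (hxc : x ∉ c) :
    c ∪ PointConfig.ofFn (fun _ : Fin 1 => x) ∈
        {c : PointConfig E | ∀ i, c.count (t i) = (Function.update n j (n j + 1) i : ℕ∞)} ↔
      c ∈ {c : PointConfig E | ∀ i, c.count (t i) = (n i : ℕ∞)} := by
  classical
  simp only [mem_setOf_eq]
  refine forall_congr' fun i => ?_
  rw [PointConfig.count_union_ofFn_one]
  by_cases hij : i = j
  · rw [hij, if_pos ⟨hx, hxc⟩, Function.update_self, Nat.cast_succ]
    exact WithTop.add_right_inj ENat.one_ne_top
  · rw [Function.update_of_ne hij, if_neg (fun h' => Set.disjoint_left.1 (hd hij) h'.1 hx),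
      add_zero]

/-- On the cylinder `C(n + e_j)` the count of `t j` is `n j + 1` (in `ℝ≥0∞`). [folklore] -/
theorem toENNReal_count_eq_of_mem_setOf_forall_count_eq_update {ι : Type*} [DecidableEq ι]
    {t : ι → Set E} (n : ι → ℕ) (j : ι) (c : PointConfig E)
    (hc : c ∈ {c : PointConfig E | ∀ i, c.count (t i) = (Function.update n j (n j + 1) i : ℕ∞)}) :
    ((c.count (t j) : ℕ∞) : ℝ≥0∞) = (n j : ℝ≥0∞) + 1 := by
  rw [hc j, Function.update_self, ENat.toENNReal_coe, Nat.cast_succ]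

end PointConfig

namespace IsPoissonPointProcess

variable {E : Type*} [TopologicalSpace E] [T2Space E] [SecondCountableTopology E]
  [MeasurableSpace E] [BorelSpace E] {ν : Measure E} {P : Measure (PointConfig E)}

/-- **The Mecke equation on an event.** Let `B ⊆ E` be measurable and `A, A'` measurable events of
configurations such that `N_c(B) = k` for `c ∈ A'` and, for every `x ∈ B` and every configuration
`c` not containing `x`, `c ∪ {x} ∈ A' ↔ c ∈ A`. Then for every measurable `f ≥ 0`,
`k · ∫_{A'} f dP = ∫_B ∫_A f(c ∪ {x}) P(dc) ν(dx)`: the Mecke equation (Last–Penrose 2017, Thm 4.1,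
(4.2); `lintegral_lintegral_toMeasure_eq`) for `F(c, x) = 1_B(x) 1_{A'}(c) f(c)` — on the left
`∫ F(c, ·) dc = N_c(B) 1_{A'}(c) f(c) = k 1_{A'}(c) f(c)`, on the right a fixed `x` is a.s. not a
point of `c` (`measure_setOf_mem_eq_zero`), so `1_{A'}(c ∪ {x}) = 1_A(c)` a.s. for `x ∈ B`.
[cite: LastPenrose2017, Thm 4.1] -/
theorem mul_setLIntegral_eq_setLIntegral_setLIntegral_insert [SigmaFinite ν]
    (h : IsPoissonPointProcess ν P) {B : Set E} (hB : MeasurableSet B) {A A' : Set (PointConfig E)}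
    (hA : MeasurableSet A) (hA' : MeasurableSet A') {k : ℝ≥0∞}
    (hk : ∀ c ∈ A', ((c.count B : ℕ∞) : ℝ≥0∞) = k)
    (hins : ∀ x ∈ B, ∀ c : PointConfig E, x ∉ c →
      (c ∪ PointConfig.ofFn (fun _ : Fin 1 => x) ∈ A' ↔ c ∈ A))
    {f : PointConfig E → ℝ≥0∞} (hf : Measurable f) :
    k * ∫⁻ c in A', f c ∂P =
      ∫⁻ x in B, ∫⁻ c in A, f (c ∪ PointConfig.ofFn (fun _ : Fin 1 => x)) ∂P ∂ν := by
  have hFm : Measurable fun p : PointConfig E × E =>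
      B.indicator (1 : E → ℝ≥0∞) p.2 * A'.indicator f p.1 :=
    ((measurable_one.indicator hB).comp measurable_snd).mul ((hf.indicator hA').comp measurable_fst)
  have key := h.lintegral_lintegral_toMeasure_eq hFm
  -- the left side: the sum over the points of `c` in `B` is the count `N_c(B) = k` on `A'`
  have hL : ∫⁻ c, ∫⁻ a, B.indicator (1 : E → ℝ≥0∞) a * A'.indicator f c ∂c.toMeasure ∂P =
      k * ∫⁻ c in A', f c ∂P := by
    have h1 : ∀ c : PointConfig E, ∫⁻ a, B.indicator (1 : E → ℝ≥0∞) a * A'.indicator f c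
        ∂c.toMeasure = k * A'.indicator f c := by
      intro c
      rw [lintegral_mul_const _ (measurable_one.indicator hB), lintegral_indicator_one hB,
        PointConfig.toMeasure_apply' c hB]
      by_cases hc : c ∈ A'
      · rw [indicator_of_mem hc, hk c hc]
      · rw [indicator_of_notMem hc, mul_zero, mul_zero]
    simp_rw [h1]
    rw [lintegral_const_mul _ (hf.indicator hA'), lintegral_indicator hA']
  -- the right side: for `x ∈ B`, a.s. `x ∉ c` and then `c ∪ {x} ∈ A' ↔ c ∈ A`
  have hR : ∫⁻ x, ∫⁻ c, B.indicator (1 : E → ℝ≥0∞) x *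
      A'.indicator f (c ∪ PointConfig.ofFn (fun _ : Fin 1 => x)) ∂P ∂ν =
      ∫⁻ x in B, ∫⁻ c in A, f (c ∪ PointConfig.ofFn (fun _ : Fin 1 => x)) ∂P ∂ν := by
    rw [← lintegral_indicator hB]
    refine lintegral_congr fun x => ?_
    by_cases hx : x ∈ B
    · simp only [indicator_of_mem hx, Pi.one_apply, one_mul]
      rw [← lintegral_indicator hA]
      refine lintegral_congr_ae ?_
      have hnull := h.measure_setOf_mem_eq_zero (a := x) (measurableSet_singleton x)
      refine (measure_eq_zero_iff_ae_notMem.1 hnull).mono fun c hxc => ?_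
      simp only [mem_setOf_eq] at hxc
      show A'.indicator f (c ∪ PointConfig.ofFn (fun _ : Fin 1 => x)) = _
      by_cases hc : c ∈ A
      · rw [indicator_of_mem ((hins x hx c hxc).2 hc), indicator_of_mem hc]
      · rw [indicator_of_notMem (fun h' => hc ((hins x hx c hxc).1 h')), indicator_of_notMem hc]
    · simp only [indicator_of_notMem hx, zero_mul, lintegral_zero]
  exact hL.symm.trans (key.trans hR)

/-- **The Mecke equation on an event, `f = 1`**: under the hypotheses of
`mul_setLIntegral_eq_setLIntegral_setLIntegral_insert`, `k · P(A') = P(A) · ν(B)`.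
[cite: LastPenrose2017, Thm 4.1] -/
theorem mul_measure_eq_measure_mul_of_insert_iff [SigmaFinite ν]
    (h : IsPoissonPointProcess ν P) {B : Set E} (hB : MeasurableSet B) {A A' : Set (PointConfig E)}
    (hA : MeasurableSet A) (hA' : MeasurableSet A') {k : ℝ≥0∞}
    (hk : ∀ c ∈ A', ((c.count B : ℕ∞) : ℝ≥0∞) = k)
    (hins : ∀ x ∈ B, ∀ c : PointConfig E, x ∉ c →
      (c ∪ PointConfig.ofFn (fun _ : Fin 1 => x) ∈ A' ↔ c ∈ A)) :
    k * P A' = P A * ν B := by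
  simpa only [setLIntegral_one, setLIntegral_const, one_mul] using
    h.mul_setLIntegral_eq_setLIntegral_setLIntegral_insert hB hA hA' hk hins
      (f := fun _ => 1) measurable_const

/-- **Monotonicity of the mean on an event under insertion** (cross-multiplied): under the
hypotheses of `mul_setLIntegral_eq_setLIntegral_setLIntegral_insert` with `0 < k < ∞`, for every
measurable `f ≥ 0` increasing for inclusion of configurations,
`(∫_A f dP) · P(A') ≤ (∫_{A'} f dP) · P(A)`: indeed `k ∫_{A'} f = ∫_B ∫_A f(c ∪ {x}) ≥ ν(B) ∫_A f`
and `k P(A') = ν(B) P(A)`; multiply the first by `P(A)`, substitute the second and cancel `k`.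
[cite: LastPenrose2017, Thm 20.4] -/
theorem setLIntegral_mul_measure_le_of_insert_iff [SigmaFinite ν]
    (h : IsPoissonPointProcess ν P) {B : Set E} (hB : MeasurableSet B) {A A' : Set (PointConfig E)}
    (hA : MeasurableSet A) (hA' : MeasurableSet A') {k : ℝ≥0∞} (hk0 : k ≠ 0) (hktop : k ≠ ∞)
    (hk : ∀ c ∈ A', ((c.count B : ℕ∞) : ℝ≥0∞) = k)
    (hins : ∀ x ∈ B, ∀ c : PointConfig E, x ∉ c →
      (c ∪ PointConfig.ofFn (fun _ : Fin 1 => x) ∈ A' ↔ c ∈ A))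
    {f : PointConfig E → ℝ≥0∞} (hf : Measurable f)
    (hmono : ∀ c c' : PointConfig E, (c : Set E) ⊆ (c' : Set E) → f c ≤ f c') :
    (∫⁻ c in A, f c ∂P) * P A' ≤ (∫⁻ c in A', f c ∂P) * P A := by
  have h1 := h.mul_setLIntegral_eq_setLIntegral_setLIntegral_insert hB hA hA' hk hins hf
  have h2 := h.mul_measure_eq_measure_mul_of_insert_iff hB hA hA' hk hins
  have h3 : ν B * ∫⁻ c in A, f c ∂P ≤ k * ∫⁻ c in A', f c ∂P := by
    rw [h1]
    calc ν B * ∫⁻ c in A, f c ∂P = ∫⁻ _ in B, ∫⁻ c in A, f c ∂P ∂ν := by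
          rw [setLIntegral_const, mul_comm]
      _ ≤ ∫⁻ x in B, ∫⁻ c in A, f (c ∪ PointConfig.ofFn (fun _ : Fin 1 => x)) ∂P ∂ν :=
          lintegral_mono fun x => lintegral_mono fun c =>
            hmono _ _ fun y hy => PointConfig.mem_union.2 (Or.inl hy)
  rw [← ENNReal.mul_le_mul_iff_right hk0 hktop]
  calc k * ((∫⁻ c in A, f c ∂P) * P A') = (∫⁻ c in A, f c ∂P) * (k * P A') := by ring
    _ = (∫⁻ c in A, f c ∂P) * (P A * ν B) := by rw [h2]
    _ = (ν B * ∫⁻ c in A, f c ∂P) * P A := by ring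
    _ ≤ (k * ∫⁻ c in A', f c ∂P) * P A := mul_le_mul' h3 le_rfl
    _ = k * ((∫⁻ c in A', f c ∂P) * P A) := by ring

/-! ## Count cylinders of a disjoint family: Mecke, the Poisson recursion, monotonicity -/

section Cylinders

variable {ι : Type*} [Countable ι] {t : ι → Set E}

/-- **The Mecke equation on a count cylinder.** For a countable pairwise disjoint family of
measurable sets `t`, `n : ι → ℕ`, `j : ι` and measurable `f ≥ 0`,
`(n j + 1) · ∫_{C(n + e_j)} f dP = ∫_{t j} ∫_{C(n)} f(c ∪ {x}) P(dc) ν(dx)` where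
`C(n) = {c | ∀ i, N_c(t i) = n i}`: the Mecke equation (Last–Penrose 2017, Thm 4.1) for
`F(c, x) = 1_{t j}(x) 1_{C(n+e_j)}(c) f(c)`, insertion of a point of `t j` moving `C(n)` to
`C(n + e_j)`. No finiteness of `ν (t j)` is needed. [cite: LastPenrose2017, Thm 4.1] -/
theorem succ_mul_setLIntegral_cylinder_succ_eq [SigmaFinite ν] (h : IsPoissonPointProcess ν P)
    [DecidableEq ι] (ht : ∀ i, MeasurableSet (t i)) (hd : Pairwise (Function.onFun Disjoint t))
    (n : ι → ℕ) (j : ι) {f : PointConfig E → ℝ≥0∞} (hf : Measurable f) :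
    ((n j : ℝ≥0∞) + 1) *
        ∫⁻ c in {c : PointConfig E | ∀ i, c.count (t i) = (Function.update n j (n j + 1) i : ℕ∞)},
          f c ∂P =
      ∫⁻ x in t j, ∫⁻ c in {c : PointConfig E | ∀ i, c.count (t i) = (n i : ℕ∞)},
        f (c ∪ PointConfig.ofFn (fun _ : Fin 1 => x)) ∂P ∂ν :=
  h.mul_setLIntegral_eq_setLIntegral_setLIntegral_insert (ht j)
    (PointConfig.measurableSet_setOf_forall_count_eq ht n)
    (PointConfig.measurableSet_setOf_forall_count_eq ht _)
    (PointConfig.toENNReal_count_eq_of_mem_setOf_forall_count_eq_update n j)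
    (fun _ hx _ hxc => PointConfig.union_ofFn_one_mem_setOf_forall_count_eq_iff hd n hx hxc) hf

/-- **The Poisson recursion for count cylinders**: `P(C(n + e_j)) · (n j + 1) = P(C(n)) · ν(t j)`
for a countable pairwise disjoint family of measurable sets (`f = 1` in
`succ_mul_setLIntegral_cylinder_succ_eq`; for finite intensities this is the recursion
`(k + 1) Po(λ)(k + 1) = λ Po(λ)(k)` in the product law of the counts).
[cite: LastPenrose2017, Thm 4.1] -/
theorem measure_cylinder_succ_mul_eq [SigmaFinite ν] (h : IsPoissonPointProcess ν P)
    [DecidableEq ι] (ht : ∀ i, MeasurableSet (t i)) (hd : Pairwise (Function.onFun Disjoint t))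
    (n : ι → ℕ) (j : ι) :
    P {c : PointConfig E | ∀ i, c.count (t i) = (Function.update n j (n j + 1) i : ℕ∞)} *
        ((n j : ℝ≥0∞) + 1) =
      P {c : PointConfig E | ∀ i, c.count (t i) = (n i : ℕ∞)} * ν (t j) := by
  rw [mul_comm]
  exact h.mul_measure_eq_measure_mul_of_insert_iff (ht j)
    (PointConfig.measurableSet_setOf_forall_count_eq ht n)
    (PointConfig.measurableSet_setOf_forall_count_eq ht _)
    (PointConfig.toENNReal_count_eq_of_mem_setOf_forall_count_eq_update n j)
    (fun _ hx _ hxc => PointConfig.union_ofFn_one_mem_setOf_forall_count_eq_iff hd n hx hxc)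

/-- **Null cylinders propagate upwards, one step**: `P(C(n)) = 0 → P(C(n + e_j)) = 0`
(from the Poisson recursion, `n j + 1 ≠ 0`). [folklore] -/
theorem measure_cylinder_succ_eq_zero [SigmaFinite ν] (h : IsPoissonPointProcess ν P)
    [DecidableEq ι] (ht : ∀ i, MeasurableSet (t i)) (hd : Pairwise (Function.onFun Disjoint t))
    (n : ι → ℕ) (j : ι) (hn : P {c : PointConfig E | ∀ i, c.count (t i) = (n i : ℕ∞)} = 0) :
    P {c : PointConfig E | ∀ i, c.count (t i) = (Function.update n j (n j + 1) i : ℕ∞)} = 0 := by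
  simpa [hn] using h.measure_cylinder_succ_mul_eq ht hd n j

/-- **Monotonicity of the conditional means of an increasing functional, one step**
(cross-multiplied, division-free form). For a Poisson point process with σ-finite intensity, a
countable pairwise disjoint family of measurable sets `t`, `n : ι → ℕ`, `j : ι`, and a measurable
`f ≥ 0` increasing for inclusion of configurations,
`(∫_{C(n)} f dP) · P(C(n + e_j)) ≤ (∫_{C(n + e_j)} f dP) · P(C(n))`,
i.e. `𝔼[f | N⃗ = n] ≤ 𝔼[f | N⃗ = n + e_j]` whenever both cylinders have positive probability (Mecke
on the cylinder and `f(c ∪ {x}) ≥ f(c)` give `(n j + 1) ∫_{C(n+e_j)} f ≥ ν(t j) ∫_{C(n)} f`; use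
the Poisson recursion and cancel `0 < n j + 1 < ∞`). The monotonicity step in the discretisation
proof of Harris–FKG for Poisson processes (Last–Penrose 2017, Thm 20.4; Roy 1991).
[cite: LastPenrose2017, Thm 20.4] -/
theorem setLIntegral_cylinder_mul_measure_succ_le [SigmaFinite ν] (h : IsPoissonPointProcess ν P)
    [DecidableEq ι] (ht : ∀ i, MeasurableSet (t i)) (hd : Pairwise (Function.onFun Disjoint t))
    (n : ι → ℕ) (j : ι) {f : PointConfig E → ℝ≥0∞} (hf : Measurable f)
    (hmono : ∀ c c' : PointConfig E, (c : Set E) ⊆ (c' : Set E) → f c ≤ f c') :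
    (∫⁻ c in {c : PointConfig E | ∀ i, c.count (t i) = (n i : ℕ∞)}, f c ∂P) *
        P {c : PointConfig E | ∀ i, c.count (t i) = (Function.update n j (n j + 1) i : ℕ∞)} ≤
      (∫⁻ c in {c : PointConfig E | ∀ i, c.count (t i) = (Function.update n j (n j + 1) i : ℕ∞)},
          f c ∂P) *
        P {c : PointConfig E | ∀ i, c.count (t i) = (n i : ℕ∞)} :=
  h.setLIntegral_mul_measure_le_of_insert_iff (ht j)
    (PointConfig.measurableSet_setOf_forall_count_eq ht n)
    (PointConfig.measurableSet_setOf_forall_count_eq ht _) (by simp) (by simp)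
    (PointConfig.toENNReal_count_eq_of_mem_setOf_forall_count_eq_update n j)
    (fun _ hx _ hxc => PointConfig.union_ofFn_one_mem_setOf_forall_count_eq_iff hd n hx hxc) hf
    hmono

omit [Countable ι] in
/-- **Monotonicity of the conditional means of an increasing functional along the coordinatewise
order** (cross-multiplied form). For a Poisson point process with σ-finite intensity, a finite
pairwise disjoint family of measurable sets `t`, count vectors `n ≤ m` (pointwise) and a
measurable `f ≥ 0` increasing for inclusion of configurations,
`(∫_{C(n)} f dP) · P(C(m)) ≤ (∫_{C(m)} f dP) · P(C(n))`, i.e. `n ↦ 𝔼[f | N⃗ = n]` is coordinatewise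
increasing on the cylinders of positive probability (if `P(C(m)) = 0` the left side vanishes):
the one-step inequality `setLIntegral_cylinder_mul_measure_succ_le` along a monotone lattice path
(`pi_nat_le_induction`, `mul_le_mul_of_le_of_update_succ`). (Layer "conditional means are
increasing" of the discretisation proof of Harris–FKG for Poisson processes, Last–Penrose 2017,
Thm 20.4.) [cite: LastPenrose2017, Thm 20.4] -/
theorem setLIntegral_cylinder_mul_measure_le_of_le [SigmaFinite ν] (h : IsPoissonPointProcess ν P)
    [Fintype ι] (ht : ∀ i, MeasurableSet (t i)) (hd : Pairwise (Function.onFun Disjoint t))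
    {f : PointConfig E → ℝ≥0∞} (hf : Measurable f)
    (hmono : ∀ c c' : PointConfig E, (c : Set E) ⊆ (c' : Set E) → f c ≤ f c') {n m : ι → ℕ}
    (hnm : n ≤ m) :
    (∫⁻ c in {c : PointConfig E | ∀ i, c.count (t i) = (n i : ℕ∞)}, f c ∂P) *
        P {c : PointConfig E | ∀ i, c.count (t i) = (m i : ℕ∞)} ≤
      (∫⁻ c in {c : PointConfig E | ∀ i, c.count (t i) = (m i : ℕ∞)}, f c ∂P) *
        P {c : PointConfig E | ∀ i, c.count (t i) = (n i : ℕ∞)} := by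
  classical
  haveI := h.isProbabilityMeasure
  exact (mul_le_mul_of_le_of_update_succ
    (a := fun k : ι → ℕ => ∫⁻ c in {c : PointConfig E | ∀ i, c.count (t i) = (k i : ℕ∞)}, f c ∂P)
    (p := fun k : ι → ℕ => P {c : PointConfig E | ∀ i, c.count (t i) = (k i : ℕ∞)})
    (fun k => measure_ne_top P _) (fun k hk => setLIntegral_measure_zero _ _ hk)
    (fun k j => h.setLIntegral_cylinder_mul_measure_succ_le ht hd k j hf hmono)
    (fun k j hk => h.measure_cylinder_succ_eq_zero ht hd k j hk) hnm).1

omit [Countable ι] in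
/-- **Null cylinders propagate upwards**: for a finite pairwise disjoint family of measurable
sets and `n ≤ m`, `P(C(n)) = 0 → P(C(m)) = 0` (iterate `measure_cylinder_succ_eq_zero` along a
monotone lattice path). [folklore] -/
theorem measure_cylinder_eq_zero_of_le [SigmaFinite ν] (h : IsPoissonPointProcess ν P)
    [Fintype ι] (ht : ∀ i, MeasurableSet (t i)) (hd : Pairwise (Function.onFun Disjoint t))
    {n m : ι → ℕ} (hnm : n ≤ m)
    (hn : P {c : PointConfig E | ∀ i, c.count (t i) = (n i : ℕ∞)} = 0) :
    P {c : PointConfig E | ∀ i, c.count (t i) = (m i : ℕ∞)} = 0 := by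
  classical
  exact pi_nat_le_induction (Q := fun k l : ι → ℕ =>
      P {c : PointConfig E | ∀ i, c.count (t i) = (k i : ℕ∞)} = 0 →
        P {c : PointConfig E | ∀ i, c.count (t i) = (l i : ℕ∞)} = 0)
    (fun _ => id) (fun _ _ _ _ _ h₁ h₂ hk => h₂ (h₁ hk))
    (fun k j => h.measure_cylinder_succ_eq_zero ht hd k j) hnm hn

end Cylinders

end IsPoissonPointProcess

end Literature.Analysis.FunctionSpaces
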